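import Literature.Probability.Percolation.Isoradial
import HarnessLib

/-!
# Grimmett–Manolescu: arm probabilities of isoradial graphs are comparable to those of `ℤ²`
(Prop. 8.1 "exp_transport", one- and two-arm cases; named fact)

Topic `Literature/Probability/Percolation`, family `crit-ising`/`crit-perc`. Companion to
`Percolation/Isoradial` (the class `𝒢(ε, I)`: `RhombicEmbedding`, `IsIsoradial`,
`IsRhombicTiling`, `HasBoundedAngles ε` = BAP(ε), `SquareGridPropertyGM I` = SGP(I); the canonical
measure `isoradialPercolation`; the arm events `embArmEvent κ N n` and probabilities `embArmProb`).
Consumer: route `Summits/CriticalPhenomena/CardyFormulaZ2/Theses/CardyRetileGlue`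
(`TransportOfGluing` / the foreseen child `SectorwiseZ2`: arm comparability across two-phase
isoradial square lattices). Source read, verbatim (G. Grimmett, I. Manolescu, *Bond percolation
on isoradial graphs: criticality and universality*, PTRF 159 (2014) = arXiv:1204.0505, §2.2 and
§8.1–8.2 of the arXiv text):

* §2.2: "Let `B_n` denote the box `[−n,n]²` of `ℝ²` […] For `N < n`, let `𝒜(N,n)` be the annulus
  `[−n,n]² ∖ (−N,N)²` […] A primal (resp. dual) crossing of `𝒜(N,n)` is an open (resp. open*)
  path whose intersection with `𝒜(N,n)` is an arc with an endpoint in each boundary of the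
  annulus. […] the arm-event `A_σ(N,n)` is the event that there exist `k` vertex-disjoint crossings
  `γ₁, …, γ_k` of `𝒜(N,n)` with colours `σᵢ` taken in anticlockwise order. The corresponding event
  on the translated annulus `𝒜^u(N,n)` is denoted `A_σ^u(N,n)` and is said to be 'centred at
  `u`'. […] When `σ = (1)`, `A_σ(N,n)` is called the one-arm-event and denoted `A₁(N,n)`. When `σ`
  is alternating with length `k = 2j`, the corresponding event is denoted `A_{2j}(N,n)`."
* §8.1: "We recall the isoradial embedding `G_{0,π/2}` of the homogeneous square lattice, with
  associated measure denoted `ℙ_{0,π/2}`. **Proposition 8.1.** Let `k ∈ {1, 2, 4, …}`, `ε > 0`,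
  and `I ∈ ℕ`. There exist constants `cᵢ = cᵢ(k, ε, I) > 0` and `N₀ = N₀(k, ε, I) ∈ ℕ` such that,
  for `N ≥ N₀`, `n ≥ c₀N₀`, `G ∈ 𝒢(ε, I)`, and any vertex `u` of `G^◇`,
  `c₁ ℙ_{0,π/2}[A_k(N,n)] ≤ ℙ_G[A_k^u(N,n)] ≤ c₂ ℙ_{0,π/2}[A_k(N,n)]`." (with Prop. 8.2
  (exp_equiv): the modified arm events of §8.2 and the arm events `A_k` centred at the same vertex
  have comparable probabilities, "`c₃ ℙ_G[A_k(N,n)] ≤ ℙ_G[Ã_k(N,n)] ≤ c₄ ℙ_G[A_k(N,n)]`", and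
  "We use the expression 'for `n > N` sufficiently large' to mean: for `n ≥ c₀N` and `N > N₀`").

## The statement in the tree's rendering, and why only `k ∈ {1, 2}`

The tree's arm event `emb.embArmEvent κ N n` (`IsoradialPercolation`) is centred at the origin of
`ℂ`, uses the sup-norm annulus with slack `2`, and — by design, see its docstring — does NOT impose
the cyclic order of the arms, only vertex-disjointness within each colour. For `k = 1` (one primal
arm, `κ = oneArmColour`) and `k = 2` (one primal and one dual arm, `κ = alternatingColours 1`) no
cyclic order is involved and the tree's event is the printed `A₁`, `A₂` up to the rendering;
for `k = 2j ≥ 4` the unordered event is a union over colour patterns, of which the printed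
Prop. 8.1 only controls the alternating one, so the `2j ≥ 4` cases are NOT vendored here (they
need arm events with cyclic order, a definition the tree does not have). "Centred at a vertex
`u ∈ G^◇`" becomes the hypothesis that the origin is the position of a primal or a dual vertex;
uniformity in `u` is then the uniformity of the constants over the class, which contains every
translate of every graph in it. The square lattice side is the tree's `squareLatticeEmbedding`
(`ℤ²` isoradially embedded, origin at the vertex `0`), whose canonical measure is `ℙ_{0,π/2}`
(= `P_{1/2}`, `isoradialPercolation_square_eq`).

So the named fact `GrimmettManolescu2014_armComparability_one_two`: for `ε > 0` and `I`, there
are `c₁, c₂ > 0`, `c₀ ≥ 1` and `N₀` such that for every `G ∈ 𝒢(ε, I)` embedded with a primal or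
dual vertex at the origin, all `N ≥ N₀` and `n ≥ c₀ N`, and `κ ∈ {oneArmColour,
alternatingColours 1}`: `c₁ P_{ℤ²}[arm κ] ≤ P_G[arm κ] ≤ c₂ P_{ℤ²}[arm κ]` — Prop. 8.1 (with 8.2)
for `k ∈ {1, 2}`, hypotheses as printed, scope `n ≥ c₀N`, `N ≥ N₀` (the text's "sufficiently
large").

Not here: the discharge (XL: star–triangle transport, §§5–8), `k = 2j ≥ 4`, the separation
theorem (Thm. 8.5), Kesten's scaling relations (§8.6).

## References

* [GrimmettManolescu2014Isoradial] G. Grimmett, I. Manolescu, PTRF 159 (2014) 411–448,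
  arXiv:1204.0505: §2.2 (arm events), §8.1 Prop. 8.1, §8.2 Prop. 8.2.
-/

noncomputable section

namespace Literature.Probability.Percolation

open LatticeModels Percolation

/-- The colour sequence of the one-arm event (a single primal arm). [cite: GrimmettManolescu2014Isoradial, §2.2 (one-arm-event A₁)] -/
def oneArmColour : Fin 1 → Bool := fun _ => true

/-- The square lattice `ℤ²` (the tree's `squareLatticeEmbedding`, GM's `G_{0,π/2}`) has its vertex
`0` at the origin, so it satisfies the centring hypothesis of the fact below. [folklore] -/
theorem squareLatticeEmbedding_z_zero : squareLatticeEmbedding.z (0 : Site 2) = 0 := by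
  show (Real.sqrt 2 : ℂ) * Site.toComplex (0 : Site 2) = 0
  have : Site.toComplex (0 : Site 2) = 0 := by apply Complex.ext <;> simp [Site.toComplex]
  rw [this, mul_zero]

/-- **Grimmett–Manolescu 2014, Prop. 8.1 (exp_transport) with Prop. 8.2, for `k ∈ {1, 2}`**
(named fact, D-0014): "There exist constants `cᵢ = cᵢ(k, ε, I) > 0` and `N₀ = N₀(k, ε, I)` such
that, for `N ≥ N₀`, `n ≥ c₀N`, `G ∈ 𝒢(ε, I)`, and any vertex `u` of `G^◇`,
`c₁ ℙ_{0,π/2}[A_k(N,n)] ≤ ℙ_G[A_k^u(N,n)] ≤ c₂ ℙ_{0,π/2}[A_k(N,n)]`" — in the tree's rendering: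
for `ε > 0` and `I : ℕ` there are `c₁, c₂ > 0`, `c₀ ≥ 1`, `N₀` such that for every countable
locally finite preconnected graph `G`, isoradially and rhombically embedded (`IsIsoradial`,
`IsRhombicTiling`) with BAP(ε) (`HasBoundedAngles ε`) and SGP(I) (`SquareGridPropertyGM I`) and
with a primal or dual vertex at the origin, the one-arm (`oneArmColour`) and two-arm
(`alternatingColours 1`) probabilities `emb.embArmProb κ N n` are within the factors `c₁, c₂` of
those of the square lattice `squareLatticeEmbedding`, for all `N ≥ N₀`, `n ≥ c₀ N`.
[cite: GrimmettManolescu2014Isoradial, §8.1 Prop. 8.1 and §8.2 Prop. 8.2 (k ∈ {1,2}); §2.2] -/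
def GrimmettManolescu2014_armComparability_one_two : Prop :=
  ∀ (ε : ℝ), 0 < ε → ∀ (I : ℕ), ∃ c₁ > (0 : ℝ), ∃ c₂ > (0 : ℝ), ∃ c₀ : ℕ, 1 ≤ c₀ ∧ ∃ N₀ : ℕ,
    ∀ (V F : Type) [Countable V] [DecidableEq V] [DecidableEq F] (G : SimpleGraph V)
      [G.LocallyFinite] (emb : RhombicEmbedding G F),
      G.Preconnected → emb.IsIsoradial → emb.IsRhombicTiling → emb.HasBoundedAngles ε →
      emb.SquareGridPropertyGM I → ((∃ v : V, emb.z v = 0) ∨ (∃ f : F, emb.c f = 0)) →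
      ∀ N n : ℕ, N₀ ≤ N → c₀ * N ≤ n →
        (c₁ * squareLatticeEmbedding.embArmProb oneArmColour N n ≤ emb.embArmProb oneArmColour N n ∧
          emb.embArmProb oneArmColour N n ≤ c₂ * squareLatticeEmbedding.embArmProb oneArmColour N n) ∧
        (c₁ * squareLatticeEmbedding.embArmProb (alternatingColours 1) N n ≤
            emb.embArmProb (alternatingColours 1) N n ∧
          emb.embArmProb (alternatingColours 1) N n ≤
            c₂ * squareLatticeEmbedding.embArmProb (alternatingColours 1) N n)

namespace GrimmettManolescu2014_armComparability_one_two

/-- **One arm** (`k = 1`), projected from the fact. [cite: GrimmettManolescu2014Isoradial, §8.1 Prop. 8.1 (k = 1)] -/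
theorem oneArm (h : GrimmettManolescu2014_armComparability_one_two) {ε : ℝ} (hε : 0 < ε) (I : ℕ) :
    ∃ c₁ > (0 : ℝ), ∃ c₂ > (0 : ℝ), ∃ c₀ : ℕ, 1 ≤ c₀ ∧ ∃ N₀ : ℕ,
      ∀ (V F : Type) [Countable V] [DecidableEq V] [DecidableEq F] (G : SimpleGraph V)
        [G.LocallyFinite] (emb : RhombicEmbedding G F),
        G.Preconnected → emb.IsIsoradial → emb.IsRhombicTiling → emb.HasBoundedAngles ε →
        emb.SquareGridPropertyGM I → ((∃ v : V, emb.z v = 0) ∨ (∃ f : F, emb.c f = 0)) →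
        ∀ N n : ℕ, N₀ ≤ N → c₀ * N ≤ n →
          c₁ * squareLatticeEmbedding.embArmProb oneArmColour N n ≤ emb.embArmProb oneArmColour N n ∧
            emb.embArmProb oneArmColour N n ≤
              c₂ * squareLatticeEmbedding.embArmProb oneArmColour N n := by
  obtain ⟨c₁, hc₁, c₂, hc₂, c₀, hc₀, N₀, H⟩ := h ε hε I
  exact ⟨c₁, hc₁, c₂, hc₂, c₀, hc₀, N₀, fun V F _ _ _ G _ emb hconn hiso hrh hbap hsgp h0 N n hN hn =>
    (H V F G emb hconn hiso hrh hbap hsgp h0 N n hN hn).1⟩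

/-- **Two arms** (`k = 2`, one primal and one dual arm), projected from the fact.
[cite: GrimmettManolescu2014Isoradial, §8.1 Prop. 8.1 (k = 2)] -/
theorem twoArm (h : GrimmettManolescu2014_armComparability_one_two) {ε : ℝ} (hε : 0 < ε) (I : ℕ) :
    ∃ c₁ > (0 : ℝ), ∃ c₂ > (0 : ℝ), ∃ c₀ : ℕ, 1 ≤ c₀ ∧ ∃ N₀ : ℕ,
      ∀ (V F : Type) [Countable V] [DecidableEq V] [DecidableEq F] (G : SimpleGraph V)
        [G.LocallyFinite] (emb : RhombicEmbedding G F),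
        G.Preconnected → emb.IsIsoradial → emb.IsRhombicTiling → emb.HasBoundedAngles ε →
        emb.SquareGridPropertyGM I → ((∃ v : V, emb.z v = 0) ∨ (∃ f : F, emb.c f = 0)) →
        ∀ N n : ℕ, N₀ ≤ N → c₀ * N ≤ n →
          c₁ * squareLatticeEmbedding.embArmProb (alternatingColours 1) N n ≤
              emb.embArmProb (alternatingColours 1) N n ∧
            emb.embArmProb (alternatingColours 1) N n ≤
              c₂ * squareLatticeEmbedding.embArmProb (alternatingColours 1) N n := by
  obtain ⟨c₁, hc₁, c₂, hc₂, c₀, hc₀, N₀, H⟩ := h ε hε I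
  exact ⟨c₁, hc₁, c₂, hc₂, c₀, hc₀, N₀, fun V F _ _ _ G _ emb hconn hiso hrh hbap hsgp h0 N n hN hn =>
    (H V F G emb hconn hiso hrh hbap hsgp h0 N n hN hn).2⟩

/-- **Comparability of two graphs of the class** (transitivity through `ℤ²`): for `G, G' ∈ 𝒢(ε, I)`
both with a vertex at the origin, `P_G[A₁] ≤ (c₂/c₁) P_{G'}[A₁]` for `N ≥ N₀`, `n ≥ c₀ N` — the form
used at a two-phase seam. [cite: GrimmettManolescu2014Isoradial, §8.1 Prop. 8.1 (k = 1)] -/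
theorem oneArm_le_of_mem_class (h : GrimmettManolescu2014_armComparability_one_two) {ε : ℝ}
    (hε : 0 < ε) (I : ℕ) :
    ∃ C > (0 : ℝ), ∃ c₀ : ℕ, 1 ≤ c₀ ∧ ∃ N₀ : ℕ,
      ∀ (V F : Type) [Countable V] [DecidableEq V] [DecidableEq F] (G : SimpleGraph V)
        [G.LocallyFinite] (emb : RhombicEmbedding G F)
        (V' F' : Type) [Countable V'] [DecidableEq V'] [DecidableEq F'] (G' : SimpleGraph V')
        [G'.LocallyFinite] (emb' : RhombicEmbedding G' F'),
        G.Preconnected → emb.IsIsoradial → emb.IsRhombicTiling → emb.HasBoundedAngles ε →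
        emb.SquareGridPropertyGM I → ((∃ v : V, emb.z v = 0) ∨ (∃ f : F, emb.c f = 0)) →
        G'.Preconnected → emb'.IsIsoradial → emb'.IsRhombicTiling → emb'.HasBoundedAngles ε →
        emb'.SquareGridPropertyGM I → ((∃ v : V', emb'.z v = 0) ∨ (∃ f : F', emb'.c f = 0)) →
        ∀ N n : ℕ, N₀ ≤ N → c₀ * N ≤ n →
          emb.embArmProb oneArmColour N n ≤ C * emb'.embArmProb oneArmColour N n := by
  obtain ⟨c₁, hc₁, c₂, hc₂, c₀, hc₀, N₀, H⟩ := h.oneArm hε I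
  refine ⟨c₂ / c₁, by positivity, c₀, hc₀, N₀, ?_⟩
  intro V F _ _ _ G _ emb V' F' _ _ _ G' _ emb' hconn hiso hrh hbap hsgp h0 hconn' hiso' hrh' hbap' hsgp'
    h0' N n hN hn
  obtain ⟨-, h2⟩ := H V F G emb hconn hiso hrh hbap hsgp h0 N n hN hn
  obtain ⟨h1', -⟩ := H V' F' G' emb' hconn' hiso' hrh' hbap' hsgp' h0' N n hN hn
  -- P_G ≤ c₂ P_sq and c₁ P_sq ≤ P_G'  ⇒  P_G ≤ (c₂/c₁) P_G'
  have hsq : squareLatticeEmbedding.embArmProb oneArmColour N n ≤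
      emb'.embArmProb oneArmColour N n / c₁ := by
    rw [le_div_iff₀ hc₁, mul_comm]; exact h1'
  calc emb.embArmProb oneArmColour N n
      ≤ c₂ * squareLatticeEmbedding.embArmProb oneArmColour N n := h2
    _ ≤ c₂ * (emb'.embArmProb oneArmColour N n / c₁) := mul_le_mul_of_nonneg_left hsq hc₂.le
    _ = c₂ / c₁ * emb'.embArmProb oneArmColour N n := by ring

end GrimmettManolescu2014_armComparability_one_two

end Literature.Probability.Percolation

end
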